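import Literature.Geometry.Symplectic.GromovCompactnessSpheresEnergy
import Literature.Geometry.Manifold.FormIntegralSingleChart
import Literature.Geometry.Symplectic.TwoChartSphereInversion
import Literature.Topology.FourManifolds.ComplexProjectiveSpacePositiveAtlas
import Mathlib.Analysis.Calculus.BumpFunction.InnerProduct
import Mathlib.MeasureTheory.Measure.Lebesgue.Complex
import HarnessLib

/-!
# The energy of a two-chart sphere, computed in the chart `z ↦ [1 : z]`

Topic `Literature/Geometry/Symplectic`, in the two-chart vocabulary of `J`-holomorphic spheres
of `GromovCompactnessSpheres.lean` (pairs `u v : ℂ → X` with `v z = u z⁻¹`, glued to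
`F : ℂℙ¹ → X` by `F [p₀ : p₁] = u (p₁/p₀) = v (p₀/p₁)`). McDuff–Salamon (2012), §2.2 define the
ENERGY of a sphere as `E(u) = ∫_{S²} u^*ω` and compute it in conformal coordinates
(Lemma 2.2.1: `E(u) = ½ ∫ |du|²_J = ∫ u^*ω` for `J`-holomorphic `u`). This file proves the
chart form of the left-hand side for the tree's integral of top forms
(`Literature.Geometry.Kaehler.MForm.integral`, constant orientation family `o₀` of `ℂℙ¹`):

* `integral_pullback_twoChartSphere_eq` — **`∫_{(ℂℙ¹, o₀)} F^*ω = sign(o₀(e₀, e₁)) ∫_ℂ (u^*ω)_z(1, i) dz`**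
  for every smooth `2`-form `ω` on `X` and every `C^∞` two-chart sphere;
* `integrable_twoChartSphere_energyDensity` — the energy density `z ↦ (u^*ω)_z(1, i)` is
  integrable on `ℂ` (finite energy);
* the bricks: the two affine charts of `ℂℙ¹` as preferred extended charts
  (`chartIndex_affineChart_symm_zero`, `extChartAt_eq_affineChart`, `affineChart_one_symm_inv`:
  `[z⁻¹ : 1] = [1 : z]`), a smooth cutoff separating the poles
  (`exists_cutoff_complexProjectiveLine`), the chart representative of `F^*ω` on the standard
  frame = the planar energy density (`inChart_pullback_glued_apply`), and the energy carried
  by one chart (`integral_smul_pullback_glued_eq`, from the single-chart integral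
  `Literature.Geometry.Manifold.integral_smul_eq_mul_setIntegral_inChart_basis` and the
  volume-preserving identification `ℝ² ≅ ℂ`).

Proof of the identity: `F^*ω = ψ F^*ω + (1 - ψ) F^*ω` (additivity of `∫`, Lee (2013),
Prop. 16.6); each piece lives in one affine chart and is computed there; the chart-`1` piece is
carried back to the chart `0` by the change of variables `w = z⁻¹`
(`TwoChartSphereInversion.lean`, conformal invariance of the energy).

Together with `GromovCompactnessSpheresEnergy.lean` (`∫_{ℂℙ¹} F^*ω = c · ⟨[ω], F_*[ℂℙ¹]⟩`) this
is the energy identity `E(u) = ⟨[ω], [u]⟩` of McDuff–Salamon (2012), Lemma 2.2.1 / (4.5.4) in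
the tree's language, the input "`sup_ν E(u^ν) < ∞`" of Gromov compactness (ibid. Thm. 5.3.1) for
`Literature.Geometry.Symplectic.gromovCompactness_spheres_dichotomy`.

Everything is proved; no definitions, no named facts.

## References

* D. McDuff, D. Salamon, *J-holomorphic Curves and Symplectic Topology*, 2nd ed., AMS
  Colloquium Publ. 52 (2012), §2.2, Lemma 2.2.1; §4.5; Thm. 5.3.1. [McDuffSalamon2012]
* J. M. Lee, *Introduction to Smooth Manifolds*, 2nd ed., GTM 218 (2013), Prop. 16.4–16.6.
  [LeeSmoothManifolds2013]
-/

noncomputable section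

open scoped Manifold ContDiff Topology EuclideanSpace
open Set Function Filter MeasureTheory Module
open Literature.Geometry.Kaehler Literature.NumberTheory.Transcendental
open Literature.Topology.FourManifolds Literature.Topology.FourManifolds.ComplexProjectiveSpace
open Literature.Geometry.Manifold

namespace Literature.Geometry.Symplectic

/-! ### The two affine charts of `ℂℙ¹` as preferred extended charts -/

/-- `σᵢ : ℂ → ℂℙ¹`, `z ↦ (affineChart i)⁻¹ (z)` (`[1 : z]` for `i = 0`, `[z : 1]` for `i = 1`), is
`C^∞` (inverse of an atlas member after a linear map). [folklore] -/
theorem contMDiff_affineChart_symm_comp (i : Fin 2) : ContMDiff 𝓘(ℝ, ℂ) (𝓡 (2 * 1)) ∞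
    (fun z : ℂ ↦ (affineChart (n := 1) i).symm (realCoordinates 1 fun _ ↦ z)) := by
  have h1 : ContMDiffOn (𝓡 (2 * 1)) (𝓡 (2 * 1)) ∞ (affineChart (n := 1) i).symm
      (affineChart (n := 1) i).target :=
    contMDiffOn_symm_of_mem_maximalAtlas
      (IsManifold.subset_maximalAtlas ((mem_atlas_iff _).2 ⟨i, rfl⟩))
  have h2 : ContMDiff 𝓘(ℝ, ℂ) 𝓘(ℝ, EuclideanSpace ℝ (Fin (2 * 1))) ∞
      (fun z : ℂ ↦ realCoordinates 1 (fun _ : Fin 1 ↦ z)) :=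
    ((realCoordinates 1).contDiff.comp (contDiff_pi.2 fun _ ↦ contDiff_id)).contMDiff
  exact (contMDiffOn_univ.1 h1).comp h2

/-- The centre `σᵢ 0` of the affine chart `i` of `ℂℙ¹` (`[1 : 0]`, resp. `[0 : 1]`) lies in no
other affine chart. [folklore] -/
theorem coordNeZero_affineChart_symm_zero_iff (i j : Fin 2) :
    CoordNeZero j ((affineChart (n := 1) i).symm (realCoordinates 1 fun _ ↦ (0 : ℂ))) ↔ j = i := by
  rw [affineChart_symm_apply, ContinuousLinearEquiv.symm_apply_apply, coordNeZero_mk]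
  constructor
  · intro h
    by_contra hji
    obtain ⟨k, rfl⟩ := Fin.exists_succAbove_eq hji
    exact h (by simp [homogenize])
  · rintro rfl
    simp [homogenize]

/-- The preferred chart at the centre `σᵢ 0` of the affine chart `i` is the affine chart `i`.
[folklore] -/
theorem chartIndex_affineChart_symm_zero (i : Fin 2) :
    chartIndex ((affineChart (n := 1) i).symm (realCoordinates 1 fun _ ↦ (0 : ℂ))) = i :=
  (coordNeZero_affineChart_symm_zero_iff i _).1 (coordNeZero_chartIndex _)

/-- On `ℂℙ¹` (model `ℝ²` without boundary) the extended chart at `p` is the affine chart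
`chartIndex p` itself. [folklore] -/
theorem extChartAt_eq_affineChart {p : ComplexProjectiveSpace 1} {i : Fin 2}
    (h : chartIndex p = i) :
    extChartAt (𝓡 (2 * 1)) p = (affineChart (n := 1) i).toPartialEquiv := by
  rw [extChartAt, ComplexProjectiveSpace.chartAt_eq, h, OpenPartialHomeomorph.extend,
    modelWithCornersSelf_partialEquiv, PartialEquiv.trans_refl]

/-- Inverse of the extended chart at a point whose preferred chart is the affine chart `i`.
[folklore] -/
theorem extChartAt_symm_apply_of_chartIndex_eq {p : ComplexProjectiveSpace 1} {i : Fin 2}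
    (h : chartIndex p = i) (y : EuclideanSpace ℝ (Fin (2 * 1))) :
    (extChartAt (𝓡 (2 * 1)) p).symm y = (affineChart (n := 1) i).symm y := by
  rw [extChartAt_eq_affineChart h]
  rfl

/-- Source of the extended chart at a point whose preferred chart is the affine chart `i`.
[folklore] -/
theorem extChartAt_source_of_chartIndex_eq {p : ComplexProjectiveSpace 1} {i : Fin 2}
    (h : chartIndex p = i) :
    (extChartAt (𝓡 (2 * 1)) p).source = {q | CoordNeZero i q} := by
  rw [extChartAt_eq_affineChart h]
  rfl

/-- The extended charts of `ℂℙ¹` have target the whole plane. [folklore] -/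
theorem extChartAt_target_of_chartIndex_eq {p : ComplexProjectiveSpace 1} {i : Fin 2}
    (h : chartIndex p = i) :
    (extChartAt (𝓡 (2 * 1)) p).target = univ := by
  rw [extChartAt_eq_affineChart h]
  rfl

/-- `realCoordinates 1 (Λ y) = y` for `Λ y = (realCoordinates⁻¹ y)₀` (`ℂ¹ = ℂ`). [folklore] -/
theorem realCoordinates_proj_symm (y : EuclideanSpace ℝ (Fin (2 * 1))) :
    realCoordinates 1 (fun _ : Fin 1 ↦
      ((ContinuousLinearMap.proj (0 : Fin 1) : (Fin 1 → ℂ) →L[ℝ] ℂ).comp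
        (realCoordinates 1).symm.toContinuousLinearMap) y) = y := by
  have h : (fun _ : Fin 1 ↦
      ((ContinuousLinearMap.proj (0 : Fin 1) : (Fin 1 → ℂ) →L[ℝ] ℂ).comp
        (realCoordinates 1).symm.toContinuousLinearMap) y) = (realCoordinates 1).symm y := by
    funext j
    obtain rfl : j = 0 := Subsingleton.elim _ _
    rfl
  rw [h, ContinuousLinearEquiv.apply_symm_apply]

/-- The inverse affine chart `i` factors through `Λ`: `(affineChart i)⁻¹ y = σᵢ (Λ y)`. [folklore] -/
theorem affineChart_symm_eq_comp (i : Fin 2) :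
    ((affineChart (n := 1) i).symm : EuclideanSpace ℝ (Fin (2 * 1)) → ComplexProjectiveSpace 1) =
      (fun z : ℂ ↦ (affineChart (n := 1) i).symm (realCoordinates 1 fun _ ↦ z)) ∘
        ((ContinuousLinearMap.proj (0 : Fin 1) : (Fin 1 → ℂ) →L[ℝ] ℂ).comp
          (realCoordinates 1).symm.toContinuousLinearMap) := by
  funext y
  simp only [comp_apply]
  rw [realCoordinates_proj_symm]

/-- `Λ` read through Mathlib's orthonormal frame `(1, i)` of `ℂ`: `Λ y = y₀ + y₁ i`. [folklore] -/
theorem proj_realCoordinates_symm_eq_orthonormalBasisOneI (y : EuclideanSpace ℝ (Fin (2 * 1))) :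
    ((ContinuousLinearMap.proj (0 : Fin 1) : (Fin 1 → ℂ) →L[ℝ] ℂ).comp
        (realCoordinates 1).symm.toContinuousLinearMap) y =
      Complex.orthonormalBasisOneI.repr.symm y := by
  rw [ContinuousLinearMap.comp_apply, ContinuousLinearMap.proj_apply,
    ContinuousLinearEquiv.coe_coe, realCoordinates_one_symm_apply_zero,
    Complex.orthonormalBasisOneI_repr_symm_apply, Complex.mk_eq_add_mul_I]

/-- For `z ≠ 0` the two inverse affine charts agree after inversion: `σ₁ (z⁻¹) = σ₀ z`
(`[z⁻¹ : 1] = [1 : z]`). [folklore] -/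
theorem affineChart_one_symm_inv {z : ℂ} (hz : z ≠ 0) :
    (affineChart (n := 1) 1).symm (realCoordinates 1 fun _ ↦ z⁻¹) =
      (affineChart (n := 1) 0).symm (realCoordinates 1 fun _ ↦ z) := by
  have h1 : CoordNeZero 1 ((affineChart (n := 1) 0).symm (realCoordinates 1 fun _ ↦ z)) := by
    rw [affineChart_symm_apply, ContinuousLinearEquiv.symm_apply_apply, coordNeZero_mk]
    simpa [homogenize] using hz
  conv_rhs => rw [← affineChart_symm_affineCoordComplex h1]
  rw [affineCoordComplex_one_eq_inv,
    Literature.Geometry.Symplectic.affineCoordComplex_affineChart_symm 0 z]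

/-! ### A cutoff separating the two poles -/

/-- If `ψ` is supported in the affine chart `i`, then `ψ ∘ σᵢ` has compact support in `ℂ` (the
support is the image of the compact `tsupport ψ` under the affine coordinate, continuous on
the chart domain). [folklore] -/
theorem hasCompactSupport_comp_affineChart_symm {ψ : ComplexProjectiveSpace 1 → ℝ} {i : Fin 2}
    (hψ : tsupport ψ ⊆ {q | CoordNeZero i q}) :
    HasCompactSupport
      (fun z : ℂ ↦ ψ ((affineChart (n := 1) i).symm (realCoordinates 1 fun _ ↦ z))) := by
  refine HasCompactSupport.intro
    (((isClosed_tsupport ψ).isCompact).image_of_continuousOn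
      ((contMDiffOn_affineCoordComplex i).continuousOn.mono hψ)) fun z hz ↦ ?_
  by_contra hne
  exact hz ⟨_, subset_tsupport _ (mem_support.2 hne),
    Literature.Geometry.Symplectic.affineCoordComplex_affineChart_symm i z⟩

/-- **A smooth cutoff on `ℂℙ¹` separating the poles**: `ψ` is `C^∞`, supported in the chart
`{p₀ ≠ 0}` (away from `∞ = [0 : 1]`), and `1 - ψ` is supported in the chart `{p₁ ≠ 0}` (away from
`0 = [1 : 0]`): `ψ = χ(p₁/p₀)` for a bump `χ` equal to `1` on the unit disc and vanishing
outside the disc of radius `2`. [folklore] -/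
theorem exists_cutoff_complexProjectiveLine :
    ∃ ψ : ComplexProjectiveSpace 1 → ℝ, ContMDiff (𝓡 (2 * 1)) 𝓘(ℝ) ∞ ψ ∧
      tsupport ψ ⊆ {q | CoordNeZero 0 q} ∧
      tsupport (fun q ↦ 1 - ψ q) ⊆ {q | CoordNeZero 1 q} := by
  classical
  let χ : ContDiffBump (0 : ℂ) := ⟨1, 2, one_pos, one_lt_two⟩
  let ψ : ComplexProjectiveSpace 1 → ℝ := fun q ↦
    if CoordNeZero 0 q then χ (affineCoordComplex 0 q 0) else 0
  have hU0 : IsOpen {q : ComplexProjectiveSpace 1 | CoordNeZero 0 q} := isOpen_setOf_coordNeZero 0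
  have hU1 : IsOpen {q : ComplexProjectiveSpace 1 | CoordNeZero 1 q} := isOpen_setOf_coordNeZero 1
  -- on the chart `{p₀ ≠ 0}` the cutoff is the bump of the affine coordinate
  have hψU0 : ContMDiffOn (𝓡 (2 * 1)) 𝓘(ℝ) ∞ ψ {q | CoordNeZero 0 q} :=
    (χ.contDiff.contMDiff.comp_contMDiffOn (contMDiffOn_affineCoordComplex 0)).congr
      fun q hq ↦ by simp only [ψ, if_pos (show CoordNeZero 0 q from hq)]; rfl
  -- a point in both charts has non-zero second affine coordinate
  have ha1 : ∀ q : ComplexProjectiveSpace 1, CoordNeZero 0 q → CoordNeZero 1 q →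
      affineCoordComplex 1 q 0 ≠ 0 := by
    intro q h0 h1
    induction q using ComplexProjectiveSpace.ind with
    | h w =>
      rw [coordNeZero_mk] at h0 h1
      rw [affineCoordComplex_mk]
      exact div_ne_zero h0 h1
  -- near `∞ = [0 : 1]` the cutoff vanishes
  set V : Set (ComplexProjectiveSpace 1) :=
    {q | CoordNeZero 1 q} ∩ (fun q ↦ affineCoordComplex 1 q 0) ⁻¹' Metric.ball 0 2⁻¹ with hV
  have hVo : IsOpen V :=
    (contMDiffOn_affineCoordComplex 1).continuousOn.isOpen_inter_preimage hU1 Metric.isOpen_ball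
  have hψV : ∀ q ∈ V, ψ q = 0 := by
    rintro q ⟨h1, hq⟩
    by_cases h0 : CoordNeZero 0 q
    · simp only [ψ, if_pos h0]
      apply χ.zero_of_le_dist
      have hne := ha1 q h0 h1
      rw [mem_preimage, Metric.mem_ball, dist_zero_right] at hq
      rw [dist_zero_right, ← inv_inv (affineCoordComplex 0 q 0), ← affineCoordComplex_one_eq_inv,
        norm_inv]
      exact (le_inv_comm₀ two_pos (norm_pos_iff.2 hne)).2 hq.le
    · simp only [ψ, if_neg h0]
  have hmemV : ∀ q : ComplexProjectiveSpace 1, ¬ CoordNeZero 0 q → q ∈ V := fun q hq ↦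
    ⟨coordNeZero_one_of_not_coordNeZero_zero hq, by
      rw [mem_preimage, affineCoordComplex_one_eq_zero hq]
      exact Metric.mem_ball_self (by positivity)⟩
  -- near `0 = [1 : 0]` the cutoff is `1`
  set W : Set (ComplexProjectiveSpace 1) :=
    {q | CoordNeZero 0 q} ∩ (fun q ↦ affineCoordComplex 0 q 0) ⁻¹' Metric.ball 0 1 with hW
  have hWo : IsOpen W :=
    (contMDiffOn_affineCoordComplex 0).continuousOn.isOpen_inter_preimage hU0 Metric.isOpen_ball
  have hψW : ∀ q ∈ W, 1 - ψ q = 0 := by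
    rintro q ⟨h0, hq⟩
    simp only [ψ, if_pos (show CoordNeZero 0 q from h0)]
    rw [sub_eq_zero, eq_comm]
    exact χ.one_of_mem_closedBall (Metric.ball_subset_closedBall hq)
  have hmemW : ∀ q : ComplexProjectiveSpace 1, ¬ CoordNeZero 1 q → q ∈ W := by
    intro q hq
    induction q using ComplexProjectiveSpace.ind with
    | h w =>
      rw [coordNeZero_mk, not_not] at hq
      have h0 : (w : Fin (1 + 1) → ℂ) 0 ≠ 0 := by
        intro h0
        obtain ⟨j, hj⟩ := exists_coordNeZero (mk w)
        rw [coordNeZero_mk] at hj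
        rcases Fin.eq_zero_or_eq_succ j with rfl | ⟨k, rfl⟩
        · exact hj h0
        · rw [Subsingleton.elim k 0] at hj
          exact hj hq
      refine ⟨(coordNeZero_mk 0 w).2 h0, ?_⟩
      rw [mem_preimage, affineCoordComplex_mk]
      change (w : Fin (1 + 1) → ℂ) ((0 : Fin (1 + 1)).succAbove 0) / (w : Fin (1 + 1) → ℂ) 0 ∈ _
      rw [show (0 : Fin (1 + 1)).succAbove 0 = 1 from rfl, hq, zero_div]
      exact Metric.mem_ball_self one_pos
  refine ⟨ψ, fun q ↦ ?_, fun q hq ↦ ?_, fun q hq ↦ ?_⟩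
  · by_cases h0 : CoordNeZero 0 q
    · exact (hψU0 q h0).contMDiffAt (hU0.mem_nhds h0)
    · exact contMDiffAt_const.congr_of_eventuallyEq
        (eventuallyEq_of_mem (hVo.mem_nhds (hmemV q h0)) fun q' hq' ↦ hψV q' hq')
  · by_contra h0
    exact (notMem_tsupport_iff_eventuallyEq.2
      (eventuallyEq_of_mem (hVo.mem_nhds (hmemV q h0)) fun q' hq' ↦ hψV q' hq')) hq
  · by_contra h1
    exact (notMem_tsupport_iff_eventuallyEq.2
      (eventuallyEq_of_mem (hWo.mem_nhds (hmemW q h1)) fun q' hq' ↦ hψW q' hq')) hq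

/-- Sign bookkeeping: `sign (x d) · sign d = sign x` for `d ≠ 0`. [folklore] -/
theorem real_sign_mul_mul_sign (x : ℝ) {d : ℝ} (hd : d ≠ 0) :
    Real.sign (x * d) * Real.sign d = Real.sign x := by
  rcases lt_or_gt_of_ne hd with hd' | hd'
  · rcases lt_trichotomy x 0 with hx | rfl | hx
    · rw [Real.sign_of_pos (mul_pos_of_neg_of_neg hx hd'), Real.sign_of_neg hd',
        Real.sign_of_neg hx]
      norm_num
    · simp [Real.sign_zero]
    · rw [Real.sign_of_neg (mul_neg_of_pos_of_neg hx hd'), Real.sign_of_neg hd',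
        Real.sign_of_pos hx]
      norm_num
  · rcases lt_trichotomy x 0 with hx | rfl | hx
    · rw [Real.sign_of_neg (mul_neg_of_neg_of_pos hx hd'), Real.sign_of_pos hd',
        Real.sign_of_neg hx]
      norm_num
    · simp [Real.sign_zero]
    · rw [Real.sign_of_pos (mul_pos hx hd'), Real.sign_of_pos hd', Real.sign_of_pos hx]
      norm_num

/-! ### The chart representative of `F^*ω` and the single-chart energy -/

section Chart

variable {X : Type} [TopologicalSpace X] [ChartedSpace (EuclideanSpace ℝ (Fin 4)) X]
  [IsManifold (𝓡 4) ∞ X]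

/-- **The chart representative of `F^*ω` is the planar energy density.** For the glued map `F`
of a two-chart sphere `(u₀, u₁)` and a point `p` whose preferred chart is the affine chart `i`,
the representative of `F^*ω` in the chart at `p`, on the standard frame, is
`y ↦ (uᵢ^*ω)_{Λ y}(1, i)` (`F ∘ (affineChart i)⁻¹ = uᵢ ∘ Λ` and `Λ (e₀, e₁) = (1, i)`; chain
rule). McDuff–Salamon (2012), §2.2 (`E(u) = ∫ u^*ω` computed in a conformal chart).
[cite: McDuffSalamon2012, Lemma 2.2.1] -/
theorem inChart_pullback_glued_apply (ωX : MForm (𝓡 4) X ℝ 2) {uv : Fin 2 → ℂ → X}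
    (huv : ∀ i, ContMDiff 𝓘(ℝ, ℂ) (𝓡 4) ∞ (uv i)) {F : ComplexProjectiveSpace 1 → X}
    (hF : ∀ i p, CoordNeZero i p → F p = uv i (affineCoordComplex i p 0))
    {p : ComplexProjectiveSpace 1} {i : Fin 2} (h : chartIndex p = i)
    (y : EuclideanSpace ℝ (Fin (2 * 1))) :
    (ωX.pullback (𝓡 (2 * 1)) F).inChart p y (PiLp.basisFun 2 ℝ (Fin (2 * 1))) =
      (ωX.pullback 𝓘(ℝ, ℂ) (uv i))
        (((ContinuousLinearMap.proj (0 : Fin 1) : (Fin 1 → ℂ) →L[ℝ] ℂ).comp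
          (realCoordinates 1).symm.toContinuousLinearMap) y) ![(1 : ℂ), Complex.I] := by
  set Λ := (ContinuousLinearMap.proj (0 : Fin 1) : (Fin 1 → ℂ) →L[ℝ] ℂ).comp
    (realCoordinates 1).symm.toContinuousLinearMap with hΛ
  set σ := (fun z : ℂ ↦ (affineChart (n := 1) i).symm (realCoordinates 1 fun _ ↦ z)) with hσ
  have hFs : ContMDiff (𝓡 (2 * 1)) (𝓡 4) ∞ F := contMDiff_glued huv hF
  have hσs : ContMDiff 𝓘(ℝ, ℂ) (𝓡 (2 * 1)) ∞ σ := contMDiff_affineChart_symm_comp i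
  have hFσ : F ∘ σ = uv i := by
    funext w
    simp only [comp_apply, hσ]
    rw [hF i _ (Literature.Geometry.Symplectic.coordNeZero_affineChart_symm i _),
      Literature.Geometry.Symplectic.affineCoordComplex_affineChart_symm]
  have hFmd : MDifferentiable (𝓡 (2 * 1)) (𝓡 4) F := hFs.mdifferentiable (by simp)
  have hσΛmd : MDifferentiable 𝓘(ℝ, EuclideanSpace ℝ (Fin (2 * 1))) (𝓡 (2 * 1)) (σ ∘ Λ) :=
    (hσs.comp Λ.contMDiff).mdifferentiable (by simp)
  have huvmd : MDifferentiable 𝓘(ℝ, ℂ) (𝓡 4) (uv i) := (huv i).mdifferentiable (by simp)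
  -- (1) the chart representative is the pull-back along the inverse chart `σ ∘ Λ`
  have h1 : (ωX.pullback (𝓡 (2 * 1)) F).inChart p y (PiLp.basisFun 2 ℝ (Fin (2 * 1))) =
      ((ωX.pullback (𝓡 (2 * 1)) F).pullback 𝓘(ℝ, EuclideanSpace ℝ (Fin (2 * 1))) (σ ∘ Λ)) y
        (PiLp.basisFun 2 ℝ (Fin (2 * 1))) := by
    rw [MForm.pullback_apply, ← affineChart_symm_eq_comp i, MForm.inChart_apply,
      extChartAt_eq_affineChart h, OpenPartialHomeomorph.coe_toPartialEquiv_symm]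
    simp only [ModelWithCorners.Boundaryless.range_eq_univ, mfderivWithin_univ]
  -- (2) functoriality: `(σ ∘ Λ)^* F^* ω = Λ^* uᵢ^* ω`
  have h2 : (ωX.pullback (𝓡 (2 * 1)) F).pullback 𝓘(ℝ, EuclideanSpace ℝ (Fin (2 * 1))) (σ ∘ Λ) =
      (ωX.pullback 𝓘(ℝ, ℂ) (uv i)).pullback 𝓘(ℝ, EuclideanSpace ℝ (Fin (2 * 1))) Λ := by
    rw [← MForm.pullback_comp hFmd hσΛmd, ← comp_assoc, hFσ,
      MForm.pullback_comp huvmd Λ.mdifferentiable]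
  rw [h1, h2, MForm.pullback_apply]
  congr 1
  funext j
  rw [ContinuousLinearMap.mfderiv_eq]
  exact lam_basisFun_eq j

/-- **The energy of a two-chart sphere carried by one chart.** For the glued map `F : ℂℙ¹ → X`
of a `C^∞` two-chart sphere `(u₀, u₁)`, a smooth `2`-form `ω` on `X`, a constant orientation
family `o₀` of `ℂℙ¹` and a `C^∞` function `ψ` supported in the affine chart `i`:
`∫_{ℂℙ¹} ψ F^*ω = sign(o₀(e₀, e₁)) ∫_ℂ ψ(σᵢ z) (uᵢ^*ω)_z(1, i) dz` — a form supported in one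
chart is integrated in that chart (Lee (2013), Prop. 16.4/16.5), the chart representative being
the energy density (`inChart_pullback_glued_apply`) and `ℝ² ≅ ℂ` measure-preserving.
McDuff–Salamon (2012), §2.2. [cite: McDuffSalamon2012, Lemma 2.2.1] -/
theorem integral_smul_pullback_glued_eq
    (o₀ : Orientation ℝ (EuclideanSpace ℝ (Fin (2 * 1))) (Fin (2 * 1)))
    (ωX : MForm (𝓡 4) X ℝ 2) (hω : IsSmoothForm ωX) {uv : Fin 2 → ℂ → X}
    (huv : ∀ i, ContMDiff 𝓘(ℝ, ℂ) (𝓡 4) ∞ (uv i)) {F : ComplexProjectiveSpace 1 → X}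
    (hF : ∀ i p, CoordNeZero i p → F p = uv i (affineCoordComplex i p 0)) (i : Fin 2)
    {ψ : ComplexProjectiveSpace 1 → ℝ} (hψ : ContMDiff (𝓡 (2 * 1)) 𝓘(ℝ) ∞ ψ)
    (hψs : tsupport ψ ⊆ {q | CoordNeZero i q}) :
    MForm.integral (I := 𝓡 (2 * 1)) (M := ComplexProjectiveSpace 1) (fun _ ↦ o₀)
        (ψ • ωX.pullback (𝓡 (2 * 1)) F) =
      Real.sign (o₀.someVector (PiLp.basisFun 2 ℝ (Fin (2 * 1)))) *
        ∫ z : ℂ, ψ ((affineChart (n := 1) i).symm (realCoordinates 1 fun _ ↦ z)) *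
          (ωX.pullback 𝓘(ℝ, ℂ) (uv i)) z ![(1 : ℂ), Complex.I] := by
  set p : ComplexProjectiveSpace 1 :=
    (affineChart (n := 1) i).symm (realCoordinates 1 fun _ ↦ (0 : ℂ)) with hp
  have h : chartIndex p = i := chartIndex_affineChart_symm_zero i
  have hFs : ContMDiff (𝓡 (2 * 1)) (𝓡 4) ∞ F := contMDiff_glued huv hF
  have hβ : IsSmoothForm (ωX.pullback (𝓡 (2 * 1)) F) := isSmoothForm_pullback hFs hω
  have hψc : HasCompactSupport ψ := (isClosed_tsupport ψ).isCompact
  have ht : (extChartAt (𝓡 (2 * 1)) p).target = univ := extChartAt_target_of_chartIndex_eq h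
  have key := integral_smul_eq_mul_setIntegral_inChart_basis (I := 𝓡 (2 * 1))
    (M := ComplexProjectiveSpace 1) (fun _ ↦ o₀) (p := p) (B := univ)
    (ε := Real.sign (o₀.someVector (modelBasis (EuclideanSpace ℝ (Fin (2 * 1))) (2 * 1))))
    (by rw [ht]) (fun y _ ↦ chartSign_const_complexProjectiveSpace o₀ p (by
      rw [ht]; exact mem_univ y))
    hψ hψc (by rw [extChartAt_source_of_chartIndex_eq h]; exact hψs) (subset_univ _) hβ
    (PiLp.basisFun 2 ℝ (Fin (2 * 1)))
  rw [key, ht, Measure.restrict_univ]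
  -- the signs: `sign o₀(e') · sign det_e(e') = sign o₀(e)` for the reference frame `e'`
  have hsign : Real.sign (o₀.someVector (modelBasis (EuclideanSpace ℝ (Fin (2 * 1))) (2 * 1))) *
      Real.sign ((PiLp.basisFun 2 ℝ (Fin (2 * 1))).det
        (modelBasis (EuclideanSpace ℝ (Fin (2 * 1))) (2 * 1))) =
      Real.sign (o₀.someVector (PiLp.basisFun 2 ℝ (Fin (2 * 1)))) := by
    have hne : (PiLp.basisFun 2 ℝ (Fin (2 * 1))).det
        (modelBasis (EuclideanSpace ℝ (Fin (2 * 1))) (2 * 1)) ≠ 0 :=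
      ((PiLp.basisFun 2 ℝ (Fin (2 * 1))).isUnit_det _).ne_zero
    rw [apply_eq_apply_basis_mul_det (PiLp.basisFun 2 ℝ (Fin (2 * 1))) o₀.someVector
      (modelBasis (EuclideanSpace ℝ (Fin (2 * 1))) (2 * 1))]
    exact real_sign_mul_mul_sign _ hne
  -- the measure: Lebesgue measure of the standard frame is the volume of `ℝ²`
  have hvol : (PiLp.basisFun 2 ℝ (Fin (2 * 1))).addHaar = volume := by
    rw [← EuclideanSpace.basisFun_toBasis]
    exact (EuclideanSpace.basisFun _ ℝ).addHaar_eq_volume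
  rw [hvol, hsign]
  congr 1
  -- the integrand is the energy density read through `Λ = (ℝ² ≅ ℂ)`, which preserves volume
  have hme : ∀ y : EuclideanSpace ℝ (Fin (2 * 1)),
      (Complex.orthonormalBasisOneI.measurableEquiv.symm y : ℂ) =
        ((ContinuousLinearMap.proj (0 : Fin 1) : (Fin 1 → ℂ) →L[ℝ] ℂ).comp
          (realCoordinates 1).symm.toContinuousLinearMap) y := fun y ↦ by
    rw [proj_realCoordinates_symm_eq_orthonormalBasisOneI]
    rfl
  have hG : (fun y ↦ ψ ((extChartAt (𝓡 (2 * 1)) p).symm y) *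
      (ωX.pullback (𝓡 (2 * 1)) F).inChart p y (PiLp.basisFun 2 ℝ (Fin (2 * 1)))) =
      fun y ↦ (fun z : ℂ ↦ ψ ((affineChart (n := 1) i).symm (realCoordinates 1 fun _ ↦ z)) *
        (ωX.pullback 𝓘(ℝ, ℂ) (uv i)) z ![(1 : ℂ), Complex.I])
          (Complex.orthonormalBasisOneI.measurableEquiv.symm y) := by
    funext y
    rw [inChart_pullback_glued_apply ωX huv hF h y, extChartAt_symm_apply_of_chartIndex_eq h y,
      hme y, congrFun (affineChart_symm_eq_comp i) y]
    rfl
  rw [hG]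
  exact (MeasurePreserving.symm _
    Complex.orthonormalBasisOneI.measurePreserving_measurableEquiv).integral_comp'
      (fun z : ℂ ↦ ψ ((affineChart (n := 1) i).symm (realCoordinates 1 fun _ ↦ z)) *
        (ωX.pullback 𝓘(ℝ, ℂ) (uv i)) z ![(1 : ℂ), Complex.I])

end Chart

/-! ### The energy identity in the chart `z ↦ [1 : z]` -/

section Energy

variable {X : Type} [TopologicalSpace X] [ChartedSpace (EuclideanSpace ℝ (Fin 4)) X]
  [IsManifold (𝓡 4) ∞ X]

/-- A cutoff supported in the chart `i`, read in that chart, times the energy density of a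
`C^∞` map `w : ℂ → X`, is integrable (continuous with compact support). [folklore] -/
theorem integrable_cutoff_mul_pullback_apply {ψ : ComplexProjectiveSpace 1 → ℝ}
    (hψ : ContMDiff (𝓡 (2 * 1)) 𝓘(ℝ) ∞ ψ) (i : Fin 2) (hψs : tsupport ψ ⊆ {q | CoordNeZero i q})
    (ωX : MForm (𝓡 4) X ℝ 2) (hω : IsSmoothForm ωX) {w : ℂ → X}
    (hw : ContMDiff 𝓘(ℝ, ℂ) (𝓡 4) ∞ w) :
    Integrable fun z : ℂ ↦ ψ ((affineChart (n := 1) i).symm (realCoordinates 1 fun _ ↦ z)) *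
      (ωX.pullback 𝓘(ℝ, ℂ) w) z ![(1 : ℂ), Complex.I] := by
  refine Continuous.integrable_of_hasCompactSupport ?_
    (hasCompactSupport_comp_affineChart_symm hψs).mul_right
  exact (hψ.continuous.comp (contMDiff_affineChart_symm_comp i).continuous).mul
    ((continuous_eval_const ![(1 : ℂ), Complex.I]).comp
      (contDiff_pullback_of_contMDiff hω hw).continuous)

/-- **The two pieces of the energy.** For a `C^∞` two-chart sphere `(u, v)` (`v z = u z⁻¹`), a
smooth `2`-form `ω` and a cutoff `ψ` as in `exists_cutoff_complexProjectiveLine`: the densities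
`ψ([1:z]) (u^*ω)_z(1,i)` and `(1 - ψ)([z⁻¹:1]) (u^*ω)_z(1,i)` are integrable and sum to the energy
density `(u^*ω)_z(1,i)` almost everywhere (`[z⁻¹ : 1] = [1 : z]` off `0`); the second is the
chart-`1` piece `(1 - ψ)([w:1]) (v^*ω)_w(1,i)` transported by `w = z⁻¹`
(`integrable_mul_pullback_iff_comp_inv`). [folklore] -/
theorem energyDensity_pieces {ψ : ComplexProjectiveSpace 1 → ℝ}
    (hψ : ContMDiff (𝓡 (2 * 1)) 𝓘(ℝ) ∞ ψ) (hψ0 : tsupport ψ ⊆ {q | CoordNeZero 0 q})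
    (hψ1 : tsupport (fun q ↦ 1 - ψ q) ⊆ {q | CoordNeZero 1 q})
    (ωX : MForm (𝓡 4) X ℝ 2) (hω : IsSmoothForm ωX) {u v : ℂ → X}
    (hu : ContMDiff 𝓘(ℝ, ℂ) (𝓡 4) ∞ u) (hv : ContMDiff 𝓘(ℝ, ℂ) (𝓡 4) ∞ v)
    (huv : ∀ z : ℂ, z ≠ 0 → v z = u z⁻¹) :
    Integrable (fun z : ℂ ↦ ψ ((affineChart (n := 1) 0).symm (realCoordinates 1 fun _ ↦ z)) *
      (ωX.pullback 𝓘(ℝ, ℂ) u) z ![(1 : ℂ), Complex.I]) ∧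
    Integrable (fun z : ℂ ↦
      (1 - ψ ((affineChart (n := 1) 1).symm (realCoordinates 1 fun _ ↦ z⁻¹))) *
        (ωX.pullback 𝓘(ℝ, ℂ) u) z ![(1 : ℂ), Complex.I]) ∧
    ((fun z : ℂ ↦ ψ ((affineChart (n := 1) 0).symm (realCoordinates 1 fun _ ↦ z)) *
        (ωX.pullback 𝓘(ℝ, ℂ) u) z ![(1 : ℂ), Complex.I] +
      (1 - ψ ((affineChart (n := 1) 1).symm (realCoordinates 1 fun _ ↦ z⁻¹))) *
        (ωX.pullback 𝓘(ℝ, ℂ) u) z ![(1 : ℂ), Complex.I]) =ᵐ[volume]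
      fun z : ℂ ↦ (ωX.pullback 𝓘(ℝ, ℂ) u) z ![(1 : ℂ), Complex.I]) := by
  have hψ' : ContMDiff (𝓡 (2 * 1)) 𝓘(ℝ) ∞ (fun q ↦ 1 - ψ q) := contMDiff_const.sub hψ
  have hvmd : MDifferentiable 𝓘(ℝ, ℂ) (𝓡 4) v := hv.mdifferentiable (by simp)
  refine ⟨integrable_cutoff_mul_pullback_apply hψ 0 hψ0 ωX hω hu,
    (integrable_mul_pullback_iff_comp_inv ωX hvmd huv (fun w ↦
      1 - ψ ((affineChart (n := 1) 1).symm (realCoordinates 1 fun _ ↦ w)))).1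
      (integrable_cutoff_mul_pullback_apply hψ' 1 hψ1 ωX hω hv), ?_⟩
  filter_upwards [(countable_singleton (0 : ℂ)).ae_notMem volume] with z hz
  rw [mem_singleton_iff] at hz
  rw [affineChart_one_symm_inv hz]
  ring

/-- **The energy of a two-chart sphere is finite**: for a `C^∞` two-chart sphere `(u, v)` and a
smooth `2`-form `ω` on `X`, the energy density `z ↦ (u^*ω)_z(1, i)` is integrable on `ℂ`
(near `∞` it is `|z|⁻⁴ (v^*ω)_{1/z}(1, i)`). McDuff–Salamon (2012), §2.2 and §4.2 (finite energy of
spheres). [cite: McDuffSalamon2012, Lemma 2.2.1] -/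
theorem integrable_twoChartSphere_energyDensity (ωX : MForm (𝓡 4) X ℝ 2) (hω : IsSmoothForm ωX)
    {u v : ℂ → X} (hu : ContMDiff 𝓘(ℝ, ℂ) (𝓡 4) ∞ u) (hv : ContMDiff 𝓘(ℝ, ℂ) (𝓡 4) ∞ v)
    (huv : ∀ z : ℂ, z ≠ 0 → v z = u z⁻¹) :
    Integrable fun z : ℂ ↦ (ωX.pullback 𝓘(ℝ, ℂ) u) z ![(1 : ℂ), Complex.I] := by
  obtain ⟨ψ, hψ, hψ0, hψ1⟩ := exists_cutoff_complexProjectiveLine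
  obtain ⟨h0, h1, hae⟩ := energyDensity_pieces hψ hψ0 hψ1 ωX hω hu hv huv
  exact (h0.add h1).congr hae

/-- **The energy identity of a two-chart sphere, in a chart** (McDuff–Salamon (2012), §2.2,
Lemma 2.2.1: `E(u) = ∫_{S²} u^*ω`, computed in the conformal chart `z ↦ [1 : z]` covering
`ℂℙ¹ ∖ {∞}`). Let `(u, v)` be a `C^∞` two-chart sphere in `X` (`v z = u z⁻¹` off `0`) with glued
map `F : ℂℙ¹ → X` (`F [p₀ : p₁] = u (p₁/p₀) = v (p₀/p₁)`), `ω` a smooth `2`-form on `X` and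
`o₀` a constant orientation family of `ℂℙ¹`. Then
`∫_{(ℂℙ¹, o₀)} F^*ω = sign(o₀(e₀, e₁)) · ∫_ℂ (u^*ω)_z(1, i) dz`.
Proof: split `F^*ω = ψ F^*ω + (1 - ψ) F^*ω` with the cutoff of
`exists_cutoff_complexProjectiveLine` (additivity of `∫`, Lee (2013), Prop. 16.6); each piece is
supported in one affine chart and is computed there (`integral_smul_pullback_glued_eq`); the
chart-`1` piece is carried to the chart `0` by `w = z⁻¹` (`integral_mul_pullback_eq_integral_comp_inv`,
conformal invariance of the energy), and the two planar integrands sum to the energy density.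
[cite: McDuffSalamon2012, Lemma 2.2.1] -/
theorem integral_pullback_twoChartSphere_eq
    (o₀ : Orientation ℝ (EuclideanSpace ℝ (Fin (2 * 1))) (Fin (2 * 1)))
    (ωX : MForm (𝓡 4) X ℝ 2) (hω : IsSmoothForm ωX) {u v : ℂ → X}
    (hu : ContMDiff 𝓘(ℝ, ℂ) (𝓡 4) ∞ u) (hv : ContMDiff 𝓘(ℝ, ℂ) (𝓡 4) ∞ v)
    (huv : ∀ z : ℂ, z ≠ 0 → v z = u z⁻¹) {F : ComplexProjectiveSpace 1 → X}
    (hF0 : ∀ p, CoordNeZero 0 p → F p = u (affineCoordComplex 0 p 0))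
    (hF1 : ∀ p, CoordNeZero 1 p → F p = v (affineCoordComplex 1 p 0)) :
    MForm.integral (I := 𝓡 (2 * 1)) (M := ComplexProjectiveSpace 1) (fun _ ↦ o₀)
        (ωX.pullback (𝓡 (2 * 1)) F) =
      Real.sign (o₀.someVector (PiLp.basisFun 2 ℝ (Fin (2 * 1)))) *
        ∫ z : ℂ, (ωX.pullback 𝓘(ℝ, ℂ) u) z ![(1 : ℂ), Complex.I] := by
  obtain ⟨ψ, hψ, hψ0, hψ1⟩ := exists_cutoff_complexProjectiveLine
  have hψ' : ContMDiff (𝓡 (2 * 1)) 𝓘(ℝ) ∞ (fun q ↦ 1 - ψ q) := contMDiff_const.sub hψ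
  have huv' : ∀ i, ContMDiff 𝓘(ℝ, ℂ) (𝓡 4) ∞ (![u, v] i) := Fin.forall_fin_two.2 ⟨hu, hv⟩
  have hF : ∀ i p, CoordNeZero i p → F p = ![u, v] i (affineCoordComplex i p 0) :=
    Fin.forall_fin_two.2 ⟨hF0, hF1⟩
  have hFs : ContMDiff (𝓡 (2 * 1)) (𝓡 4) ∞ F := contMDiff_glued huv' hF
  have hβ : IsSmoothForm (ωX.pullback (𝓡 (2 * 1)) F) := isSmoothForm_pullback hFs hω
  have hvmd : MDifferentiable 𝓘(ℝ, ℂ) (𝓡 4) v := hv.mdifferentiable (by simp)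
  obtain ⟨h0, h1, hae⟩ := energyDensity_pieces hψ hψ0 hψ1 ωX hω hu hv huv
  -- split `F^*ω` by the cutoff and integrate each piece in its chart
  have hsplit : ωX.pullback (𝓡 (2 * 1)) F =
      ψ • ωX.pullback (𝓡 (2 * 1)) F + (fun q ↦ 1 - ψ q) • ωX.pullback (𝓡 (2 * 1)) F := by
    funext q
    rw [Pi.add_apply, Pi.smul_apply', Pi.smul_apply', ← add_smul, add_sub_cancel, one_smul]
  have hadd := MForm.integral_add_holds (I := 𝓡 (2 * 1)) (M := ComplexProjectiveSpace 1)
    (fun _ ↦ o₀) (isContinuousOrientation_const_complexProjectiveSpace 1 o₀)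
    (hβ.fun_smul hψ) (hβ.fun_smul hψ')
  rw [← hsplit] at hadd
  rw [hadd, integral_smul_pullback_glued_eq o₀ ωX hω huv' hF 0 hψ hψ0,
    integral_smul_pullback_glued_eq o₀ ωX hω huv' hF 1 hψ' hψ1, ← mul_add]
  congr 1
  simp only [Matrix.cons_val_zero, Matrix.cons_val_one]
  rw [integral_mul_pullback_eq_integral_comp_inv ωX hvmd huv (fun w ↦
      1 - ψ ((affineChart (n := 1) 1).symm (realCoordinates 1 fun _ ↦ w))),
    ← integral_add h0 h1]
  exact integral_congr_ae hae

end Energy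

end Literature.Geometry.Symplectic

end
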